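import Mathlib
import Summits.Ventures.FusionMHD.Models.SAlphaPolyWitnessS25A48Panels0
import HarnessLib

/-!
# F3 «F3.BALLOON-sα-S25-A48-POLY-WITNESS»: at `(s, α) = (5/2, 24/5)` — just BELOW the model's SECOND stability edge at shear `5/2` (float `4.91`) — the `s–α` ballooning MODEL is on the UNSTABLE side: an explicit polynomial trial function on `[−4, 4]` with kernel-certified NEGATIVE energy (`SAlpha.UnstableWitness (5/2) (24/5) (−4) 4`); the companion `SAlphaPolyWitnessS25A398` joins it to ★ #250's lens, making the certified unstable set at `s = 5/2` the connected interval `[13/8, 24/5]`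

LADDER-GRIDFUSION rung F3 (cell `gridfusion`; the unstable side near the SECOND edge at the shear `s = 5/2`).  Assembly by gridfusion-model-7 g9, 2026-08-28,
in model-7's poly-witness lane: (i) the data file `SAlphaPolyWitnessS25A48Defs` (a NEW even degree-22 polynomial `X = UX` on `[−4, 4]`, float Rayleigh–Ritz design at
`(5/2, 19/4)`, exact dyadics, `X(±4) = 0`; program `pw11Prog` at `(5/2, 24/5)`), (ii) ONE panel file (11 kernel-decided Taylor-model integral enclosures, graded grid
`1/4` on `[0, 3]`, `1/8` on `[3, 15/4]`, `1/16` on `[15/4, 4]`), (iii) here: the point theorem.  The companion file `SAlphaPolyWitnessS25A398` certifies the SAME `X` at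
`α = 199/50 = lensHi (5/2)` and, by lit-3's convexity in `α`, the interval `[199/50, 24/5]`.  0 kit in the kernel objects; no `native_decide`; `π` does not enter.

## THREE COLUMNS
CERTIFIED: in the `s–α` ballooning MODEL (Freidberg (12.96)–(12.99)) at `(s, α) = (5/2, 24/5)` the explicit trial function `X = Poly.eval UX` on `[−4, 4]` (even
polynomial of degree 22 vanishing at `±4`) has one-surface energy `W ≤ −4/25 < 0` (`X(0) ≈ 1`): `SAlpha.UnstableWitness (5/2) (24/5) (−4) 4 X X′`
(`unstableWitness_fiveHalves_48`) — the unstable set `U_{5/2}` contains `24/5 = 4.8`, so the model's SECOND stability edge at shear `5/2` (if any stable surface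
lies above) is `≥ 24/5`; no stable surface above it is certified yet at this shear (lit-4's tail lemma would need a core of length ≥ 23 at `(5/2, 21/4)`); nothing
typed about monotonicity.  VALIDATED (not in the kernel): E–L shooting (model-7 kit j304843, even + odd, zero on `(0, 150]`) puts the second edge at `α ≈ 4.91` for
`s = 5/2`; float energies of this `X` along `s = 5/2`: `−1.80, −1.50, −1.25, −0.78, −0.28, −0.17, −0.056, +0.063` at `α = 3.5, 3.98, 4.2, 4.5, 4.75, 4.8, 4.85, 4.9`;
kernel enclosure of the half integral `[−0.085811, −0.084743]`.  MODELLED: `s–α` model (large-aspect-ratio shifted circles, high-`n` ballooning ordering,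
`θ₀ = 0`, ideal MHD); «unstable» = the MODEL's one-surface energy admits a negative compactly supported trial function (lit-3's witness class; representation step
`W̄ < 0 ⇒ δW < 0`, Connor–Hastie–Taylor 1979, quoted in the Literature file, NOT typed); nothing about `θ₀ ≠ 0`, a device, or a `β`-limit.  Citations: Freidberg 2014
§12.3 (12.38)–(12.40), §12.6.2 (12.97)–(12.100), Fig. 12.5 [Freidberg2014]; Mahboubi–Melquiond–Sibut-Pinote 2016 [MahboubiMelquiondSibutpinote2016]; Makino–Berz 2003
[MakinoBerz2003].  Everything below is [instance data].
-/

open MeasureTheory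
open Literature.Analysis.ValidatedNumerics Literature.Analysis.ValidatedNumerics.PolyMP
open Literature.Analysis.ValidatedNumerics.NumericsMP Literature.Analysis.ValidatedNumerics.ExpPoly
open Literature.MathematicalPhysics.MHD.Ballooning
open Real Set

namespace Summit.Ventures.FusionMHD.Models

namespace SAlphaPolyWitnessS25A48

/-! ### §1 The trial function: derivative, zeros at `±4`, parity -/

/-- `Poly.deriv UX = UXd`. [instance data] -/
private theorem deriv_UX : Poly.deriv UX = UXd := by
  decide +kernel

/-- `X(4) = 0` (exact). [instance data] -/
private theorem UX_at_L : Poly.eval UX (4 : ℝ) = 0 := by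
  norm_num [UX, Poly.eval]

/-- `X(−4) = 0` (exact). [instance data] -/
private theorem UX_at_negL : Poly.eval UX (-4 : ℝ) = 0 := by
  norm_num [UX, Poly.eval]

/-- `X` is even. [instance data] -/
private theorem UX_even (θ : ℝ) : Poly.eval UX (-θ) = Poly.eval UX θ := by
  simp only [UX, Poly.eval]
  push_cast
  ring

/-- `X′` is odd. [instance data] -/
private theorem UXd_odd (θ : ℝ) : Poly.eval UXd (-θ) = -Poly.eval UXd θ := by
  simp only [UXd, Poly.eval]
  push_cast
  ring

/-- `X′ = Poly.eval UXd` is the derivative of `X = Poly.eval UX` everywhere. [instance data] -/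
private theorem hasDerivAt_UX (θ : ℝ) : HasDerivAt (Poly.eval UX) (Poly.eval UXd θ) θ := by
  have h := Poly.hasDerivAt_eval UX θ
  rwa [deriv_UX] at h

/-! ### §2 The energy density of `X`: parity, continuity, the certified half-window integral -/

/-- The energy density of the even `X` is even in `θ`. [instance data] -/
private theorem density_even (θ : ℝ) : (SAlpha.energyDensity (5 / 2) (24 / 5) (Poly.eval UX) (Poly.eval UXd)) (-θ) = (SAlpha.energyDensity (5 / 2) (24 / 5) (Poly.eval UX) (Poly.eval UXd)) θ := by
  unfold SAlpha.energyDensity SAlpha.bending SAlpha.drive SAlpha.shearParam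
  rw [UX_even, UXd_odd, Real.sin_neg, Real.cos_neg]
  ring

/-- The energy density of `X` is continuous. [instance data] -/
private theorem density_continuous : Continuous (SAlpha.energyDensity (5 / 2) (24 / 5) (Poly.eval UX) (Poly.eval UXd)) := by
  have h1 : Continuous (Poly.eval UX) := Poly.continuous_eval UX
  have h2 : Continuous (Poly.eval UXd) := Poly.continuous_eval UXd
  unfold SAlpha.energyDensity SAlpha.bending SAlpha.drive SAlpha.shearParam
  fun_prop

/-- THE CERTIFIED HALF-WINDOW INTEGRAL: `∫₀^4 [(1+Λ²)X′² − α(Λ sin θ + cos θ)X²] dθ ≤ -2/25` (kernel enclosure of the 11 panels: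
`[-0.085810, -0.084743]`; float value `-0.085283`). [instance data] -/
theorem half_integral_le : ∫ θ in (0 : ℝ)..4, (SAlpha.energyDensity (5 / 2) (24 / 5) (Poly.eval UX) (Poly.eval UXd)) θ ≤ (-2 / 25 : ℝ) := by
  have hseg := pw11_seg0
  have hb := (hseg.bounds (by norm_num) (lo' := -1) (hi' := -2/25) (by norm_num) (by norm_num)).2
  have e0 : ((panelLeft (1/4 : ℚ) 0 : ℚ) : ℝ) = 0 := by norm_num [panelLeft]
  have e1 : ((panelLeft (1/16 : ℚ) 32 : ℚ) : ℝ) = 4 := by norm_num [panelLeft]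
  have ei : ∀ t : ℝ, (TProg.toFunP (pw11Prog UX UXd) []) t * Poly.eval [1] t = (SAlpha.energyDensity (5 / 2) (24 / 5) (Poly.eval UX) (Poly.eval UXd)) t := by
    intro t
    rw [toFunP_pw11Prog]
    simp [Poly.eval]
  rw [e0, e1] at hb
  simp only [ei] at hb
  norm_num at hb ⊢
  exact hb

/-- THE CERTIFIED ENERGY: `W[X; −4, 4] ≤ -4/25 < 0` (reflection `θ ↦ −θ` doubles the half-window integral). [instance data] -/
theorem energy_le : SAlpha.energy (5 / 2) (24 / 5) (Poly.eval UX) (Poly.eval UXd) (-4) 4 ≤ (-4 / 25 : ℝ) := by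
  unfold SAlpha.energy
  have hint : ∀ a b : ℝ, IntervalIntegrable (SAlpha.energyDensity (5 / 2) (24 / 5) (Poly.eval UX) (Poly.eval UXd)) volume a b :=
    fun a b => density_continuous.intervalIntegrable a b
  have hsplit := intervalIntegral.integral_add_adjacent_intervals (hint (-4) 0) (hint 0 4)
  have hrefl : ∫ θ in (-4 : ℝ)..0, (SAlpha.energyDensity (5 / 2) (24 / 5) (Poly.eval UX) (Poly.eval UXd)) θ = ∫ θ in (0 : ℝ)..4, (SAlpha.energyDensity (5 / 2) (24 / 5) (Poly.eval UX) (Poly.eval UXd)) θ := by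
    have h1 := intervalIntegral.integral_comp_neg (a := (0 : ℝ)) (b := 4) (SAlpha.energyDensity (5 / 2) (24 / 5) (Poly.eval UX) (Poly.eval UXd))
    simp only [neg_zero] at h1
    rw [← h1]
    exact intervalIntegral.integral_congr fun x _ => density_even x
  have hh := half_integral_le
  linarith

/-! ### §3 The witness -/

/-- **THE ROW: `(s, α) = (5/2, 24/5)` IS ON THE UNSTABLE SIDE OF THE `s–α` MODEL** — the explicit even polynomial `X = Poly.eval UX`
(degree 22, `X(±4) = 0`) is a compactly supported trial function on the window `[−4, 4]` with NEGATIVE one-surface energy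
(`≤ -4/25` with `X(0) ≈ 1`), i.e. an `SAlpha.UnstableWitness 5/2 (24/5) (−4) 4`.  MODEL `s–α`; «unstable» in the model's own one-surface (Newcomb / trial-function)
sense; nothing about a device. [instance data] -/
theorem unstableWitness_fiveHalves_48 : SAlpha.UnstableWitness (5 / 2) (24 / 5) (-4) 4 (Poly.eval UX) (Poly.eval UXd) := by
  refine ⟨by norm_num, fun θ _ => hasDerivAt_UX θ, UX_at_negL, UX_at_L, ?_⟩
  have h := energy_le
  linarith

end SAlphaPolyWitnessS25A48

end Summit.Ventures.FusionMHD.Models
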